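import Mathlib
import HarnessLib
import HarnessLib.Audit
import Summits.CriticalPhenomena.Statement
import Literature.Probability.Percolation.CardyFormula
import Literature.Probability.Percolation.SmirnovSeparatingData
import Literature.Probability.Percolation.SmirnovDiscreteCauchy
import Literature.Probability.Percolation.ChayesLeiHex
import HarnessLib.Audit.Status.Attr

/-!
Route: CardyBondTriangular

DORMANT since 2026-08-26T12:03:57Z (reconciler: no traction for 8.3 d (last activity item-evidence-added at 2026-08-18T03:33:38Z); parked, not closed — `ledger route dormant route-CriticalPhenomena-CardyBondTriangular --off` to reactiva) — unstaffed, not closed; items shared with open routes are served there. `ledger route dormant <id> --off` reactivates.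

# Route CardyBondTriangular — bond-T anchor — Cardy for canonical bond percolation on the triangular
lattice by Bollobás–Riordan's contour argument with approximate colour switching, then star–triangle
transport T → Z²

It suffices to show X = X_T ∧ X_tr ∧ X_br (card
CriticalPhenomena/CardyFormulaZ2/bond-triangular-anchor).
(X_T) BondTriangularCardy: canonical bond percolation on the triangular lattice 𝕋 — independent
edges, each open with probability criticalWeight(π/6) = 2 sin(π/18) (Wierman's critical point, which
is also the Grimmett–Manolescu isoradial weight of 𝕋, `criticalWeight_pi_div_six`) — satisfies
Cardy's formula for EVERY conformal rectangle in the crude discretisation `embDomainCrossing`, for 𝕋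
embedded with unit circumradius and up-triangle centroids on √3·𝕋 (z x = √3·(triEmbed x − (1+ζ)/3):
the one normalisation in which both the isoradial rhombi of 𝒢 and Bollobás–Riordan's face-centre
observable are literal).
(X_tr) TriangularToSquareTransport: whatever crude crossing limits Φ(η) bond-𝕋 has for all conformal
rectangles, bond-ℤ² at p = 1/2 (crude event, `squareLatticeEmbedding.z`) has the same — o(1)
star–triangle transport between two explicit bi-periodic members of 𝒢.
(X_br) DiscretisationBridge: on ℤ² the crude event and G02's `discreteCrossing` have the same Cardy
limit (item shared verbatim with route CardyIsoradial, stmt-CriticalPhenomena-0787).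
Lean: `BondTriangularCardy ∧ TriangularToSquareTransport ∧ DiscretisationBridge`
Lean (X_T spelled out): `∀ R : Literature.Probability.RandomPlanarGeometry.ConformalRectangle,
R.HasCrossingLimit (fun δ ↦ (Literature.Probability.Percolation.bondPercolation
Literature.Probability.LatticeModels.triGraph (Literature.Probability.LatticeModels.criticalWeightI
(Real.pi / 6))).real (Literature.Probability.Percolation.embDomainCrossing (fun x :
Literature.Probability.LatticeModels.Site 2 ↦ (Real.sqrt 3 : ℂ) *
(Literature.Probability.LatticeModels.triEmbed x - (1 +
Literature.Probability.LatticeModels.triZeta) / 3)) R.carrier δ (R.arc 0) (R.arc 2)))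
Literature.Probability.RandomPlanarGeometry.cardyFunction`

## Assembly
Pure logic: BondTriangularCardy is the hypothesis of TriangularToSquareTransport at Φ =
cardyFunction; its conclusion is the hypothesis of DiscretisationBridge, whose conclusion is
CardyFormulaZ2 — `fun hT hTr hB R => hB R (hTr _ hT R)`, checked in the planner sketch (Sketch.lean,
rc 0). Side glue (not items): BondTriangularCardy ∧ TriIsoradialInstance → CardyIsoradial.IsoAnchor
(checked); SeparatingDataToCardy discharges BondTriangularCardy from Bollobás–Riordan separating
data for bond-𝕋.

Rationale: WHY THIS LINE. Smirnov's contour argument needs two things: equilateral dual faces (Beffara's ψ ≡ 0,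
Beffara2008Universal §4.1) and exact colour switching (BollobasRiordan2006 Ch.7 Lemma 6 p.172 /
Lemma 12). Bond-ℤ² has neither; independent critical bond percolation on 𝕋, in Chayes–Lei's
hexagon-tiling ("packaged triangle") representation (ChayesLei2006; ChayesLei2007 §2.1 pp.4-5:
hexagons = up-triangles, pure yellow/blue with probability a = e = λ²(3−2λ), three of the six split
hexagons with probability s = λ(1−λ)² each, λ = 2 sin(π/18)), HAS the first and misses the second
only through the half-mesh shift primal-𝕋 ↔ dual-hexagonal ↔ star–triangle image — the same single
defect ℤ² carries. So: prove Cardy where one defect remains and carry it to ℤ² by isoradial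
star–triangle transport (GrimmettManolescuAOP2013, GrimmettManolescu2014Isoradial p.2 'includes
isoradial embeddings of periodic graphs', DKKMO2020Rotational; HansenManolescu2024LargeScale
announced for bi-periodic graphs, Manolescu2025ExploringFK Rem. 5.6). What makes the line cheap to
STATE and to START: the tree holds a complete kernel-checked Bollobás–Riordan proof of Smirnov's
theorem (`smirnov_tendsto_triDomainCrossingProb_holds`,
`hasCrossingLimit_triDomainCrossingProb_holds`) whose analytic half is model-agnostic
(`IsSeparatingData` → `IsSmirnovFamily.tendsto_apply_one`, (M) and (U) proved) and whose summation
by parts takes colour switching as an abstract hypothesis (14)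
(`norm_discreteTriangleIntegral_sub_mul_le`); for bond-𝕋 only the percolation inputs change —
RSW/arm separation (Wierman1981, GrimmettManolescuAOP2013; tree fact `gm_boxCrossing` over 𝒢) and
(14), which must now hold APPROXIMATELY with a summable defect (the card's mechanism: holonomy c³ =
1 for microscopic constants by the exact 120° symmetry + mesoscopic colour switching with a rate;
filed after open as the informal rank-2 crux MesoscopicColourSwitching with its reduction
SwitchingReduction). Imported areas: discrete complex analysis (Smirnov/BR, reused from the tree),
Yang–Baxter/star–triangle integrability (GM, DKKMO). Versus existing routes: CardyIsoradial asks
IsoAnchor existentially and CrossingLimitInvariance over ALL of 𝒢 including aperiodic Penrose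
tilings; this route NAMES the anchor (bond-𝕋, ψ ≡ 0) and needs transport only between two
bi-periodic lattices; BondTriangularCardy ∧ TriIsoradialInstance → CardyIsoradial.IsoAnchor is
term-checked in the planner sketch, so closing X_T also closes CardyIsoradial's rank-3 crux.
CardyHarmonicInvariants/CardyDiscreteHolo run Smirnov-type arguments on ℤ² where ψ ≢ 0; none of them
touches 𝕋. Related live cards (not realised here, cross-referenced):
macroscopic-switching-free-and-useless (the leading-order RATIO form of colour switching is provable
on ℤ² and useless — the holomorphic content sits in the subleading term of relative size r^(1/3);
consistent with this route demanding the o(δ)-per-face / o(nδ)-summed defect, threshold 1/3 = 1 −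
2/3), one-obstruction-bowtie-lemma (the ℤ² bookkeeping of the same defect through Beffara's covering
lattice; on bond-𝕋 the bow-ties are Chayes–Lei's split hexagons), arm-ratio-rate-measurement
(Monte-Carlo design for θ₃ > 1/3 on ℤ², transposable to bond-𝕋 = this route's cheapest falsifier).
Negatives index at filing: stmt-CriticalPhenomena-0772 (SAW) only, unrelated.

RANKED CRUXES. #3 BondTriangularCardy (crux) — Cardy's formula for canonical bond percolation on 𝕋
(p = criticalWeightI(π/6) = 2 sin(π/18)) for every conformal rectangle, crude discretisation
`embDomainCrossing`, embedding z x = √3(triEmbed x − (1+ζ)/3) (card item 'Crux 1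
BondTriangularCardy'). Other similarity copies of 𝕋 give formally different (2δ slack, translated)
events; this normalisation is the one both glue items below use. Rank 3 because rank 2 is the
informal mechanism crux MesoscopicColourSwitching (filed after open), of which this is the parent.
[difficulty: open-problem] (why it might fail: As open as the conjunct for a FIXED bond lattice
(Grimmett2014ICM §5(B)); ChayesLei2007 p.5 'beyond our present capabilities', p.26 mesoscopic CR
relations 'obscure'; exact colour switching fails microscopically on bond-T (primal vs
dual-hexagonal arms); no approximate version in print.) [ChayesLei2007, ChayesLei2006,
BollobasRiordan2006, Grimmett2014ICM, Wierman1981, SmirnovPercolationLong2009, Beffara2008Universal]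
#4 TriangularToSquareTransport (crux) — for every Φ : ℝ → ℝ, if bond-𝕋 (canonical weights, embedding
as above) has crude crossing limits Φ(η) for all conformal rectangles then so does bond-ℤ² at p =
1/2 (crude event with `squareLatticeEmbedding.z`). The (𝕋, ℤ²) specialisation of CardyIsoradial's
CrossingLimitInvariance: both are bi-periodic members of 𝒢 (GrimmettManolescu2014Isoradial p.2),
joined by star–triangle track exchanges through the mixed square/triangular lattices of
GrimmettManolescuAOP2013 (tree vocabulary: `mixedPercolation`, `exchangeTracks`,
StarTriangleCoupling). Implied by CrossingLimitInvariance (stmt-0785) + TriIsoradialInstance + the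
square-lattice instance facts. [difficulty: XL] (why it might fail: each star–triangle move
displaces paths by O(1) and a sweep uses ≍δ⁻² moves; o(1)-exact coupling of macroscopic crossings is
proved only among rectangular isoradial embeddings of Z² (DKKMO2020Rotational Thm 2.1/2.3), T needs
a third track family; [HM24] (bi-periodic) unreleased.) [GrimmettManolescuAOP2013,
GrimmettManolescu2014Isoradial, DKKMO2020Rotational, HansenManolescu2024LargeScale,
Manolescu2025ExploringFK, Grimmett2014ICM]
#5 DiscretisationBridge (crux) — (shared verbatim with route CardyIsoradial,
stmt-CriticalPhenomena-0787) on ℤ² at p = 1/2, Cardy for the crude embedded crossing event (open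
path with all vertices in Ω, endpoints within 2δ of the arcs) implies Cardy for G02's
`bondDomainCrossingProb` (largest component Ω_δ, discrete arcs): boundary RSW re-routing at o(1)
cost. [difficulty: L] (why it might fail: Per-R over ALL Jordan R: BR2006's boundary-immateriality
is a sandwich via approximating domains needing convergence there; a direct o(1) coupling needs
boundary arm bounds at arbitrary ∂Ω; largest component = bulk is proved only for volume(∂Ω) = 0.)
[BollobasRiordan2006, Grimmett2018, tree:Literature.Probability.Percolation.embDomainCrossing,
tree:Literature.Probability.LatticeModels.meshDomain,
tree:Literature.Probability.LatticeModels.exists_forall_mem_meshDomain_and_reachable]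
#9 SeparatingDataToCardy (support) — the analytic half of Bollobás–Riordan's proof, instantiated for
bond-𝕋 (provable now — the planner holds a kernel-checked proof in the unit folder, Glue.lean,
attached as item evidence): if for every conformal rectangle with a Carleson datum (IsEquilateral a
b c, d ∈ (c, a), IsCarlesonMap) there are discrete separating data (IsSeparatingData R (triangleTurn
a b c) S f) for an inner and an outer approximation sandwiching the bond-𝕋 crude crossing
probability at embDomain-mesh δ/√3 (at BR-mesh δ the Chayes–Lei hexagon centres = up-triangle
centroids sit on the standard lattice δ𝕋 and the observable on its face centres δ·hexCenter, so
IsSeparatingData is used literally), then BondTriangularCardy. Proof: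
`smirnov_exists_separatingFamilies_of_separatingData` + `IsSmirnovFamily.tendsto_apply_one` ((M)
`triangleIntegral_eq_zero_of_forall_lattice_holds`, (U) `smirnov_claim24_holds`) +
`exists_isCarlesonMap_holds` + `cardyFunction_crossRatio_eq_carlesonRatio_holds`, with
`triDomainCrossingProb` replaced by the sandwiched function (cf.
`smirnov_tendsto_triDomainCrossingProb_of_limitArgument`,
`hasCrossingLimit_triDomainCrossingProb_of_carleson`), and the reparametrisation δ ↦ √3 δ of 𝓝[>] 0.
[difficulty: provable-now] [BollobasRiordan2006,
tree:Literature.Probability.Percolation.smirnov_exists_separatingFamilies_of_separatingData,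
tree:Literature.Probability.Percolation.smirnov_tendsto_triDomainCrossingProb_of_limitArgument,
tree:Literature.Probability.Percolation.hasCrossingLimit_triDomainCrossingProb_of_carleson]
#9 TriIsoradialInstance (support) — 𝕋 with z x = √3(triEmbed x − (1+ζ)/3) is a member of 𝒢 whose
canonical law is bond-𝕋 at criticalWeightI(π/6): `triGraph` is preconnected (zdGraph 2 ≤ triGraph);
the rhombic embedding with this z, faces HexVertex centred at the (scaled, shifted) triangle
centroids and left/right faces `triEdgeFaces`, is isoradial (corner–centre distance √3/√3 = 1), a
rhombic tiling (the rhombille tiling), has the H21 square-grid property (two of its three parallel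
track families; the third crosses both in order) and BAP(π/6) (every half-angle equals π/6), and its
`isoradialPercolation` is `bondPercolation triGraph (criticalWeightI (π/6))` (as
`isoradialPercolation_squareLattice`). Glue value: with BondTriangularCardy it yields
CardyIsoradial.IsoAnchor (term checked in the planner sketch); with
CardyIsoradial.CrossingLimitInvariance and the six square-lattice instance facts it yields
TriangularToSquareTransport. [difficulty: M] [GrimmettManolescu2014Isoradial, Kenyon2002,
tree:Literature.Probability.LatticeModels.RhombicEmbedding.isoradialPercolation_squareLattice,
tree:Literature.Probability.Percolation.isRhombicTiling_squareLatticeEmbedding,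
tree:Literature.Probability.Percolation.criticalWeight_pi_div_six]
#9 ApproxDiscreteCauchy (support) — Bollobás–Riordan's Lemma 13 summation by parts with a
colour-switching DEFECT (deterministic, provable now — kernel-checked in the unit folder with C =
24, ApproxCauchy.lean, attached as item evidence): in the format of
`norm_discreteTriangleIntegral_sub_mul_le` (arbitrary F on face centres and g on pairs of adjacent
faces of δ𝕋 inside a lattice triangular contour with n edges per side; (10) exact, (12) |g| ≤ ε) but
with (14) replaced by |g^(i+1)(w, z_(j+1)) − g^i(w, z_j)| ≤ η at every face inside, the discrete
Cauchy defect is ≤ 6nδε + C·n²·δ·η for an absolute constant C (C = 3 expected: n² interior faces ×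
dual edge length δ/√3 × |2ζ − 1| = √3, entering through (15)). With η = o(δ) uniformly on compacta
(n ≍ L/δ) this is the `cauchy` field of IsSeparatingData; it is the slot where
MesoscopicColourSwitching enters. [difficulty: provable-now] [BollobasRiordan2006,
tree:Literature.Probability.Percolation.norm_discreteTriangleIntegral_sub_mul_le,
tree:Literature.Probability.Percolation.norm_discreteTriangleIntegral_sub_mul_le_local]
#9 IsoAnchorGlue (support) — cross-route glue (provable now; term checked in the planner sketch,
axioms clean): BondTriangularCardy → TriIsoradialInstance → IsoAnchor, where IsoAnchor is route
CardyIsoradial's rank-3 crux (stmt-CriticalPhenomena-0786) inlined verbatim — so closing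
BondTriangularCardy and TriIsoradialInstance closes CardyIsoradial's anchor as well (instantiate V =
Site 2, F = HexVertex, G = triGraph, ε = π/6, rewrite the canonical law and the embedding).
[difficulty: provable-now] [GrimmettManolescu2014Isoradial, Grimmett2014ICM,
tree:Summit.CriticalPhenomena.CardyFormulaZ2.Theses.CardyIsoradial.IsoAnchor]

TWO-LAYER PLAN. Foreseen, NOT filed as splits now: BondTriangularCardy ⇐ MesoscopicColourSwitching →
SwitchingReduction → BondTriangularCardy, where MesoscopicColourSwitching (informal rank-2 crux,
filed after open by workitem add; signature after the definition request lands) = Bollobás–Riordan's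
(14) for the Chayes–Lei hexagon representation of bond-𝕋 with a per-face defect o(δ) — equivalently
relative switching error ρ(δ) with ρ·P(3 arms) = o(δ), e.g. ρ = O(δ^α), α > 1/3 granted the 3-arm
bound δ^(2/3) — or at least the SUMMED defect over the faces inside a contour = o(n δ); and
SwitchingReduction (informal support) = MesoscopicColourSwitching ∧ RSW/annulus arm bounds for
bond-𝕋 ∧ the tree's Lemma-14 domains (`tri_exists_discreteApprox_proof`, reusable because the CL
hexagons ARE the sites of δ𝕋) ⇒ the separating data of SeparatingDataToCardy, via
ApproxDiscreteCauchy. TriangularToSquareTransport ⇐ (a) DKKMO-type coupling for one exchange of a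
π/3-track with the square grid, (b) GM2013's finite sequence of exchanges 𝕃(π/2) → mixed → 𝕋, (c)
boundary bookkeeping o(1) — split only after (a) is typed against `mixedPercolation`.

KILL CRITERIA. ¬BondTriangularCardy (a conformal rectangle whose bond-𝕋 crossing limit exists and
differs from F(η), or fails to exist) refutes percolation universality for a periodic critical
lattice — closes the route (and CardyIsoradial's anchor strategy) outright.
¬TriangularToSquareTransport likewise contradicts universality between 𝕋 and ℤ²; closes the route. A
refutation of MesoscopicColourSwitching in its summed form (e.g. kit measurement of the three
colour-pattern 3-arm probabilities on bond-𝕋 showing a summed defect ≍ n δ or worse) kills the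
MECHANISM: pivot BondTriangularCardy to the Chayes–Lei deformation prong (crossing limits constant
along the exactly critical family a = e, s ↓ from the six-split colour-symmetric model) or close as
exhausted. ¬DiscretisationBridge signals a mis-specified discretisation — report to operator (shared
with CardyIsoradial), not a refutation of the line. Mooted if CardyIsoradial proves IsoAnchor with
another anchor AND CrossingLimitInvariance.

NOT DECOMPOSED YET. The percolation inputs for bond-𝕋 (RSW at 2 sin(π/18), annulus 3-arm bound = BR
Lemma 4 analogue, arm separation), the bond-𝕋 discrete domains and separating events (definition
request below), the holonomy lemma c³ = 1 (only meaningful once a ratio-limit statement is typed;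
the novelty audit notes it presupposes a domain-independent local constant), the quantitative form
of TriangularToSquareTransport (rate per track exchange × number of exchanges), and the Chayes–Lei
deformation prong (SixSplitEndpointCardy, CriticalFamilyConstancy) — all layer-2, after
MesoscopicColourSwitching is typed or a crux closes.

CHEAPEST FALSIFIER. kit computation on bond-𝕋 at p = 2 sin(π/18) in an equilateral triangle of side
R = 16…256: for a face w at the centre, estimate the three Bollobás–Riordan probabilities P(B₁B₂W₃),
P(B₁W₂B₃), P(W₁B₂B₃) (two primal arms + one dual hexagonal arm to the three sides, odd arm rotating)
and the signed sum over faces inside a contour of side R/2; the mechanism needs the pairwise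
differences to be o(R⁻¹·P) pointwise or the contour sum to be o(R·δ-units); a defect decaying like
P·R^(-α) with α ≤ 1/3 and no cancellation in the sum retires MesoscopicColourSwitching (not
BondTriangularCardy). Not run here (hub is compute-free for planners in plancard mode; filed as the
refuter's first check). Lookup falsifier already run: ChayesLei2007 §5 item 2 (p.26) records that
mesoscopic Cauchy–Riemann relations are 'obscure with any deviation from the microscopic hexagonal
geometry' — a warning, not a counterexample.

NUMBERS. p_c(bond 𝕋) = 2 sin(π/18) = 0.3473 (Wierman1981; tree `criticalWeight_pi_div_six`,
`kappa_triangular`); Chayes–Lei parameters of independent bond-𝕋: a = e = λ²(3 − 2λ) = 0.2781, s =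
λ(1 − λ)² = 0.1479 (a + e + 3s = 1 ⇔ λ³ − 3λ + 1 = 0), FKG iff ae ≥ 2s² (0.0773 ≥ 0.0438 ✓,
ChayesLei2007 p.5); half-angle of 𝕋 = π/6, BAP(π/6); polychromatic 3-arm exponent 2/3 (site 𝕋,
SmirnovWerner2001) ⇒ switching-rate threshold α > 1/3 (card); BR Lemma 13 constants: 6nδε (tree) + C
n²δη, C = 3 expected.

DEFINITION REQUESTS. (1) ChayesLeiHexPercolation: the Chayes–Lei hexagon-tiling (packaged-triangle)
model PT(a, e, s) on the sites of 𝕋 (hexagon states: pure yellow, pure blue, three splits α, β, γ;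
half-edge connectivity), its yellow/blue connectivity, the exact dictionary with independent bond
percolation on 𝕋 at (a, e, s) = (λ³ + 3λ²(1−λ), (1−λ)³, λ(1−λ)²) (ChayesLei2006, ChayesLei2007
§2.1–2.2), and Bollobás–Riordan separating events/probabilities `clSepProb`, `clSepDiffProb` on
`TriMarkedDomain 3` for it (topic Literature/Probability/Percolation) — needed to give
MesoscopicColourSwitching and SwitchingReduction signatures. (2) Optional: a named
`triIsoradialEmbedding : RhombicEmbedding triGraph HexVertex` realising TriIsoradialInstance (topic
Literature/Probability/LatticeModels). Cite facts wanted: Wierman1981 (p_c of bond 𝕋/hexagonal),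
ChayesLei2006 Thm (criticality a = e, FKG iff ae ≥ 2s²).

Novelty: Searches (2026-08-15; `lit search` daemon down — ConnectionReset on every call, recorded in
NOTES.md; used the other tools): `lit galaxy search "bond-triangular" --star all` (3 rows:
ChayesLei2007 pdf, Grimmett Probability on Graphs, BollobasRiordan2006), `lit galaxy search "Cardy's
formula bond triangular" --star all` (0), `lit galaxy search "color switching" --star all` (19 rows,
none mathematical), `lit vsearch` ×2 (books only: Kesten1982, Grimmett1999/2006/2010, BR2006), `lit
frontier CriticalPhenomena --since 2021` (30 descendants, none on bond-𝕋 crossing limits), `lit read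
arxiv:math-ph/0601023` pp.3–5, 26 (ChayesLei2007), `lit read book:bollobas2006-percolation` pp.164,
171–172, 203, `lit read arxiv:1204.0505` pp.2–3, 6 (GM2014: 𝒢 ⊇ periodic isoradial graphs), plus the
card's searches and the refuter novelty audit of the card (CL2006, CL2007 §5, Beffara grep, Grimmett
ICM grep). Tree search: `lean search` for triangular/isoradial/Smirnov decls — found the complete BR
proof of Smirnov's theorem (SmirnovTheoremHolds) and the generic Lemma-13 core.
Nearest prior art found: ChayesLei2007 (arXiv:math-ph/0601023 = doi:10.1142/s0129055x0700305x):
Cardy for the flower models of bond-triangular type, full bond-𝕋 'beyond our present capabilities'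
(p.5); BollobasRiordan2006 p.164 ('Smirnov's proof depends essentially on special properties of T')
and p.203 ('It remains an important challenge to prove conformal invariance for any other standard
model'); Grimmett2014ICM §5(B) + Grim  [refs: 10.1142/s0129055x0700305x, math-ph/0601023, 1204.0505, arxiv:math-ph/0601023, book:bollobas2006-percolation, arxiv:1204.0505, doi:10.1142/s0129055x0700305x, ChayesLei2007, BollobasRiordan2006, Kesten1982, Grimmett1999, GM2014]

Barriers (technique_class: colour-switching, isoradial-anchor, star-triangle-transport): - technique_class: colour-switching, isoradial-anchor, star-triangle-transport
- Literature.Barriers.CriticalPhenomena.SmirnovTriangularOnly: EVADED by construction for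
BondTriangularCardy — the contour argument is run only on the hexagon tiling of bond-𝕋 where every
dual face is a regular hexagon corner-triangle (beffaraPsi ≡ 0; the barrier's own evasion (iii) =
Chayes–Lei models is the starting point); what remains is the model-specific colour switching, about
which the barrier prints no impossibility (its 'because' clause names it as the only model-specific
input). It APPLIES verbatim to any attempt to run the argument on ℤ², which this route never does.
- Literature.Barriers.CriticalPhenomena.CoveringLatticeShiftNarrow: APPLIES in substance to the
Chayes–Lei hexagon representation of bond-𝕋 — the colour flip alone maps the three admissible split
hexagons to the three forbidden ones, and flip ∘ reflection preserves the measure but moves the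
boundary labels (ChayesLei2007 p.4: 'reflection followed by color reversal'), so every EXACT
colour-switching identity obtained from a lattice symmetry alone or the flip alone is blocked
exactly as for Beffara's G_s; EVADED because the route asks only for the barrier's own NOT-blocked
item (b): a RATE statement for the colour-switching / label-rotation defect
(MesoscopicColourSwitching: per-face defect o(δ), or summed defect o(nδ) over the faces inside a
contour), consumed through ApproxDiscreteCauchy — i.e. precisely Beffara's 'what is

History (route lifecycle, newest last):
- 2026-08-26T12:03:57Z · DORMANT — reconciler: no traction for 8.3 d (last activity item-evidence-added at 2026-08-18T03:33:38Z); parked, not closed — `ledger route dormant route-CriticalPhenomen (operator:999:3809583)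

sub-problem: CardyFormulaZ2 · status: dormant · opened planner-plancard-CriticalPhenomena-CardyFormu-50fd54cb-0 2026-08-15T11:34:47Z · rev 3 · ledger route-CriticalPhenomena-CardyBondTriangular
GENERATED by the gate from the ledger (D-0016/17). Provers cite these decls: `theorem foo : Summit.CriticalPhenomena.CardyFormulaZ2.Theses.CardyBondTriangular.<Decl> := …` in Summits/CriticalPhenomena/CardyFormulaZ2/Theorems/<Name>.lean.
-/

namespace Summit.CriticalPhenomena.CardyFormulaZ2.Theses.CardyBondTriangular

open scoped BigOperators Topology Manifold Classical MeasureTheory ProbabilityTheory Matrix InnerProductSpace ComplexConjugate ContinuousMap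
open Filter Set Function TopologicalSpace MeasureTheory

attribute [summit_statement] _root_.CardyFormulaZ2

/-- item stmt-CriticalPhenomena-5003 · crux · rank 2 · open · by planner
why it might fail: Exact switching (BR2006 L.6) fails microscopically on bond-𝕋 (2 primal + 1 dual-hex arm); soft inputs give only the leading-order ratio, the needed o(δ)·P per face / o(nδ) summed defect is subleading (rel. ≍ r^(1/3)); colour-independence of even arm exponents is open for bond models (GM2011 §1.3).
sources: BollobasRiordan2006, ChayesLei2007, ChayesLei2006, GrimmettManolescu2011, Beffara2008Universal, SmirnovWerner2001
[crux] MesoscopicColourSwitching (card bond-triangular-anchor, Crux 2; informal until the definition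
request ChayesLeiHexPercolation/clSepDiffProb lands). For critical independent bond percolation on 𝕋
(p = 2 sin(π/18)) in its Chayes–Lei hexagon representation (hexagons = up-triangles = sites of the
standard lattice δ𝕋; ChayesLei2007 §2.1–2.2), let G be a 3-marked discrete domain (tree:
TriMarkedDomain 3, the Lemma-14 domains G_δ^∓ of a conformal triangle) and, for a face w of δ𝕋 with
opposite faces z_0, z_1, z_2 (oppFace, anticlockwise), let h^i_δ(w, z_j) = P(E^i_δ(z_j) \ E^i_δ(w))
be the differences of Bollobás–Riordan's separating probabilities (BollobasRiordan2006 Ch.7 (9)-(10)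
p.180; E^i(z): a YELLOW = primal path from arc A_{i+1} to arc A_{i+2} separates z from A_i), i.e.
the probabilities of the 3-arm events 'two primal (𝕋) arms from two vertices of w to A_{i+1},
A_{i+2} and one dual (hexagonal / half-edge) arm from w to A_i' (BR Claim 10/11). CLAIM (summed
form, what the route consumes): for every compact K ⊂ Ω there is e_K(δ) → 0 such that for every
lattice triangular contour C ⊂ K with n edges per side, ‖Σ_{faces w inside C} Σ_{j ∈ Fin 3} (z_j −
w)·(h^{i+1}_δ(w, z_{j+1}) -/
@[route_item "route-CriticalPhenomena-CardyBondTriangular", crux]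
def MesoscopicColourSwitching : Prop :=
  ∀ (R : Literature.Probability.RandomPlanarGeometry.ConformalRectangle) (G : ℝ → Literature.Probability.Percolation.TriMarkedDomain 4), Literature.Probability.Percolation.IsDiscreteApprox R G → ∃ e : ℝ → ℝ, Tendsto e (𝓝[>] 0) (𝓝 0) ∧ ∀ K : Set ℂ, IsCompact K → K ⊆ R.carrier → ∀ᶠ δ in 𝓝[>] (0 : ℝ), ∀ (i : Fin 3) (x : Literature.Probability.LatticeModels.Site 2) (n : ℕ) (s : ℝ), (s = δ ∨ s = -δ) → convexHull ℝ ({Literature.Probability.LatticeModels.triMeshPoint δ x, Literature.Probability.LatticeModels.triMeshPoint δ x + n * s, Literature.Probability.LatticeModels.triMeshPoint δ x + n * s * Literature.Probability.LatticeModels.triZeta} : Set ℂ) ⊆ K → ‖∑ w ∈ ((G δ).dropLast.faces.filter fun w => ∀ v ∈ Literature.Probability.LatticeModels.hexFaceVertices w, Literature.Probability.LatticeModels.triMeshPoint δ v ∈ convexHull ℝ ({Literature.Probability.LatticeModels.triMeshPoint δ x, Literature.Probability.LatticeModels.triMeshPoint δ x + n * s, Literature.Probability.LatticeModels.triMeshPoint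 δ x + n * s * Literature.Probability.LatticeModels.triZeta} : Set ℂ)), ∑ j : Fin 3, ((δ : ℂ) * Literature.Probability.LatticeModels.hexCenter (Literature.Probability.Percolation.oppFace w j) - (δ : ℂ) * Literature.Probability.LatticeModels.hexCenter w) * (((G δ).dropLast.clSepDiffProb Literature.Probability.Percolation.ChayesLeiHexPercolation.triBondCritical (i + 1) w (Literature.Probability.Percolation.oppFace w (j + 1)) - (G δ).dropLast.clSepDiffProb Literature.Probability.Percolation.ChayesLeiHexPercolation.triBondCritical i w (Literature.Probability.Percolation.oppFace w j) : ℝ) : ℂ)‖ ≤ n * δ * e δ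

/-- item stmt-CriticalPhenomena-4664 · crux · rank 3 · open · by planner
why it might fail: As open as the conjunct for a FIXED bond lattice (Grimmett2014ICM §5(B): Cardy 'as yet unproven for all isoradial bond percolation models'; ChayesLei2007 p.5 'beyond our present capabilities', p.26 CR 'obscure'); exact colour switching fails microscopically on bond-𝕋; no approximate form in print.
sources: ChayesLei2007, ChayesLei2006, BollobasRiordan2006, Grimmett2014ICM, Wierman1981, SmirnovPercolationLong2009
[crux] Cardy's formula for canonical bond percolation on 𝕋 (p = criticalWeightI(π/6) = 2 sin(π/18))
for every conformal rectangle, crude discretisation `embDomainCrossing`, embedding z x = √3(triEmbed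
x − (1+ζ)/3) (card item 'Crux 1 BondTriangularCardy'). Other similarity copies of 𝕋 give formally
different (2δ slack, translated) events; this normalisation is the one both glue items below use.
Rank 3 because rank 2 is the informal mechanism crux MesoscopicColourSwitching (filed after open),
of which this is the parent. [difficulty: open-problem] -/
@[route_item "route-CriticalPhenomena-CardyBondTriangular", crux]
def BondTriangularCardy : Prop :=
  ∀ R : Literature.Probability.RandomPlanarGeometry.ConformalRectangle, R.HasCrossingLimit (fun δ ↦ (Literature.Probability.Percolation.bondPercolation Literature.Probability.LatticeModels.triGraph (Literature.Probability.LatticeModels.criticalWeightI (Real.pi / 6))).real (Literature.Probability.Percolation.embDomainCrossing (fun x : Literature.Probability.LatticeModels.Site 2 ↦ (Real.sqrt 3 : ℂ) * (Literature.Probability.LatticeModels.triEmbed x - (1 + Literature.Probability.LatticeModels.triZeta) / 3)) R.carrier δ (R.arc 0) (R.arc 2))) Literature.Probability.RandomPlanarGeometry.cardyFunction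

/-- item stmt-CriticalPhenomena-4665 · crux · rank 4 · open · by planner
why it might fail: Each star–triangle move displaces paths by O(1), a sweep uses ≍δ⁻² moves; an o(1) coupling of macroscopic crossings is in print only inside the rectangular family 𝕃(α) ≅ ℤ² (DKKMO2020 Thm 2.1/2.3, Manolescu2025 Thm 5.3); 𝕋 needs a third track family — only [HM24], in preparation, not on arXiv.
sources: GrimmettManolescuAOP2013, GrimmettManolescu2014Isoradial, DKKMO2020Rotational, HansenManolescu2024LargeScale, Manolescu2025ExploringFK, Grimmett2014ICM
[crux] for every Φ : ℝ → ℝ, if bond-𝕋 (canonical weights, embedding as above) has crude crossing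
limits Φ(η) for all conformal rectangles then so does bond-ℤ² at p = 1/2 (crude event with
`squareLatticeEmbedding.z`). The (𝕋, ℤ²) specialisation of CardyIsoradial's CrossingLimitInvariance:
both are bi-periodic members of 𝒢 (GrimmettManolescu2014Isoradial p.2), joined by star–triangle
track exchanges through the mixed square/triangular lattices of GrimmettManolescuAOP2013 (tree
vocabulary: `mixedPercolation`, `exchangeTracks`, StarTriangleCoupling). Implied by
CrossingLimitInvariance (stmt-0785) + TriIsoradialInstance + the square-lattice instance facts.
[difficulty: XL] -/
@[route_item "route-CriticalPhenomena-CardyBondTriangular", crux]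
def TriangularToSquareTransport : Prop :=
  ∀ Φ : ℝ → ℝ, (∀ R : Literature.Probability.RandomPlanarGeometry.ConformalRectangle, R.HasCrossingLimit (fun δ ↦ (Literature.Probability.Percolation.bondPercolation Literature.Probability.LatticeModels.triGraph (Literature.Probability.LatticeModels.criticalWeightI (Real.pi / 6))).real (Literature.Probability.Percolation.embDomainCrossing (fun x : Literature.Probability.LatticeModels.Site 2 ↦ (Real.sqrt 3 : ℂ) * (Literature.Probability.LatticeModels.triEmbed x - (1 + Literature.Probability.LatticeModels.triZeta) / 3)) R.carrier δ (R.arc 0) (R.arc 2))) Φ) → ∀ R : Literature.Probability.RandomPlanarGeometry.ConformalRectangle, R.HasCrossingLimit (fun δ ↦ (Literature.Probability.Percolation.bondPercolation (Literature.Probability.LatticeModels.zdGraph 2) Literature.Probability.Percolation.half).real (Literature.Probability.Percolation.embDomainCrossing Literature.Probability.LatticeModels.squareLatticeEmbedding.z R.carrier δ (R.arc 0) (R.arc 2))) Φ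

/-- item stmt-CriticalPhenomena-0787 · crux · rank 5 · closed · proved by Summit.CriticalPhenomena.CardyFormulaZ2.Cruxes.DiscretisationBridge.Birth.DiscretisationBridge_skeleton @ b5325d8714b8 (prover) · by planner
why it might fail: Per-R over ALL Jordan R: BR2006's boundary-immateriality (L.14, p.195) is a sandwich via approximating domains needing convergence THERE, which a per-R hypothesis lacks; a direct o(1) coupling needs boundary arm bounds at arbitrary ∂Ω; largest component Ω_δ = bulk is proved only for volume(∂Ω)=0.
sources: BollobasRiordan2006, Grimmett2018, book:bollobas2006-percolation Ch.7 p.157, Lemma 14 pp.183-195 with remark p.195 (boundary treatment immaterial THROUGH the sandwich domains G_δ^±, site-𝕋 only), proof of Thm 2 p.202, tree:Literature.Probability.Percolation.embDomainCrossing, tree:Literature.Probability.LatticeModels.meshDomain, tree:Literature.Probability.LatticeModels.exists_forall_mem_meshDomain_and_reachable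
[crux] Discretisation bridge on Z^2: Cardy for the crude embedded crossing event (embDomainCrossing
squareLatticeEmbedding.z: open path with all vertices in Ω, endpoints within 2δ of the arcs (ab),
(cd)) under P_{1/2} implies Cardy for G02's bondDomainCrossingProb (largest component Ω_δ of Ω ∩
δZ^2, discrete arcs by distance comparison). Content: boundary RSW on Z^2 — crossings can be
re-routed near ∂Ω at o(1) cost; the Literature notes neither statement formally implies the other
(CardyFormula module doc, flag (i)). -/
@[route_item "route-CriticalPhenomena-CardyBondTriangular", crux]
def DiscretisationBridge : Prop :=
  ∀ R : Literature.Probability.RandomPlanarGeometry.ConformalRectangle, R.HasCrossingLimit (fun δ ↦ (Literature.Probability.Percolation.bondPercolation (Literature.Probability.LatticeModels.zdGraph 2) Literature.Probability.Percolation.half).real (Literature.Probability.Percolation.embDomainCrossing Literature.Probability.LatticeModels.squareLatticeEmbedding.z R.carrier δ (R.arc 0) (R.arc 2))) Literature.Probability.RandomPlanarGeometry.cardyFunction → R.HasCrossingLimit (Literature.Probability.Percolation.bondDomainCrossingProb R) Literature.Probability.RandomPlanarGeometry.cardyFunction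

-- `DiscretisationBridge` holds: proved by `Summit.CriticalPhenomena.CardyFormulaZ2.Cruxes.DiscretisationBridge.Birth.DiscretisationBridge_skeleton` @ b5325d8714b8 (its module imports this route file, so no `_holds` link can be stated here).

/-- item stmt-CriticalPhenomena-4666 · support · rank 9 · closed · proved by Summit.CriticalPhenomena.CardyFormulaZ2.Theorems.separatingDataToCardy_proof (prover) · by planner
sources: BollobasRiordan2006, tree:Literature.Probability.Percolation.smirnov_exists_separatingFamilies_of_separatingData, tree:Literature.Probability.Percolation.smirnov_tendsto_triDomainCrossingProb_of_limitArgument, tree:Literature.Probability.Percolation.hasCrossingLimit_triDomainCrossingProb_of_carleson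
[support] the analytic half of Bollobás–Riordan's proof, instantiated for bond-𝕋 (provable now — the
planner holds a kernel-checked proof in the unit folder, Glue.lean, attached as item evidence): if
for every conformal rectangle with a Carleson datum (IsEquilateral a b c, d ∈ (c, a), IsCarlesonMap)
there are discrete separating data (IsSeparatingData R (triangleTurn a b c) S f) for an inner and an
outer approximation sandwiching the bond-𝕋 crude crossing probability at embDomain-mesh δ/√3 (at
BR-mesh δ the Chayes–Lei hexagon centres = up-triangle centroids sit on the standard lattice δ𝕋 and
the observable on its face centres δ·hexCenter, so IsSeparatingData is used literally), then
BondTriangularCardy. Proof: `smirnov_exists_separatingFamilies_of_separatingData` +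
`IsSmirnovFamily.tendsto_apply_one` ((M) `triangleIntegral_eq_zero_of_forall_lattice_holds`, (U)
`smirnov_claim24_holds`) + `exists_isCarlesonMap_holds` +
`cardyFunction_crossRatio_eq_carlesonRatio_holds`, with `triDomainCrossingProb` replaced by the
sandwiched function (cf. `smirnov_tendsto_triDomainCrossingProb_of_limitArgument`,
`hasCrossingLimit_triDomainCrossingProb_of_carleson`), and the reparametrisation δ ↦ √3 δ -/
@[route_item "route-CriticalPhenomena-CardyBondTriangular"]
def SeparatingDataToCardy : Prop :=
  (∀ (R : Literature.Probability.RandomPlanarGeometry.ConformalRectangle) (a b c d : ℂ) (ψ : Literature.Probability.RandomPlanarGeometry.ConformalEquiv R.carrier (Literature.Probability.Percolation.openTriangle a b c)), Literature.Probability.Percolation.IsEquilateral a b c → d ∈ openSegment ℝ c a → Literature.Probability.Percolation.IsCarlesonMap R a b c d ψ → ∃ (Sm Sp : ℝ → Finset ℂ) (fm fp : ℝ → Fin 3 → ℂ → ℝ), Literature.Probability.Percolation.IsSeparatingData R (Literature.Probability.Percolation.triangleTurn a b c) Sm fm ∧ Literature.Probability.Percolation.IsSeparatingData R (Literature.Probability.Percolation.triangleTurn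 a b c) Sp fp ∧ ∃ (zm zp : ℝ → ℂ) (e : ℝ → ℝ), (∀ᶠ δ in 𝓝[>] (0 : ℝ), zm δ ∈ Sm δ ∧ zm δ ∈ R.carrier ∧ zp δ ∈ Sp δ ∧ zp δ ∈ R.carrier) ∧ Tendsto zm (𝓝[>] 0) (𝓝 (R.pt 3)) ∧ Tendsto zp (𝓝[>] 0) (𝓝 (R.pt 3)) ∧ Tendsto e (𝓝[>] 0) (𝓝 0) ∧ ∀ᶠ δ in 𝓝[>] (0 : ℝ), fm δ 1 (zm δ) - e δ ≤ (Literature.Probability.Percolation.bondPercolation Literature.Probability.LatticeModels.triGraph (Literature.Probability.LatticeModels.criticalWeightI (Real.pi / 6))).real (Literature.Probability.Percolation.embDomainCrossing (fun x : Literature.Probability.LatticeModels.Site 2 ↦ (Real.sqrt 3 : ℂ) * (Literature.Probability.LatticeModels.triEmbed x - (1 + Literature.Probability.LatticeModels.triZeta) / 3)) R.carrier (δ / Real.sqrt 3) (R.arc 0) (R.arc 2)) ∧ (Literature.Probability.Percolation.bondPercolation Literature.Probability.LatticeModels.triGraph (Literature.Probability.LatticeModels.criticalWeightI (Real.pi /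 6))).real (Literature.Probability.Percolation.embDomainCrossing (fun x : Literature.Probability.LatticeModels.Site 2 ↦ (Real.sqrt 3 : ℂ) * (Literature.Probability.LatticeModels.triEmbed x - (1 + Literature.Probability.LatticeModels.triZeta) / 3)) R.carrier (δ / Real.sqrt 3) (R.arc 0) (R.arc 2)) ≤ fp δ 1 (zp δ) + e δ) → ∀ R : Literature.Probability.RandomPlanarGeometry.ConformalRectangle, R.HasCrossingLimit (fun δ ↦ (Literature.Probability.Percolation.bondPercolation Literature.Probability.LatticeModels.triGraph (Literature.Probability.LatticeModels.criticalWeightI (Real.pi / 6))).real (Literature.Probability.Percolation.embDomainCrossing (fun x : Literature.Probability.LatticeModels.Site 2 ↦ (Real.sqrt 3 : ℂ) * (Literature.Probability.LatticeModels.triEmbed x - (1 + Literature.Probability.LatticeModels.triZeta) / 3)) R.carrier δ (R.arc 0) (R.arc 2))) Literature.Probability.RandomPlanarGeometry.cardyFunction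

-- `SeparatingDataToCardy` holds: proved by `Summit.CriticalPhenomena.CardyFormulaZ2.Theorems.separatingDataToCardy_proof` (its module imports this route file, so no `_holds` link can be stated here).

/-- item stmt-CriticalPhenomena-4667 · support · rank 9 · closed · proved by Summit.CriticalPhenomena.CardyFormulaZ2.Theorems.triIsoradialInstance_proof (prover) · by planner
sources: GrimmettManolescu2014Isoradial, Kenyon2002, tree:Literature.Probability.LatticeModels.RhombicEmbedding.isoradialPercolation_squareLattice, tree:Literature.Probability.Percolation.isRhombicTiling_squareLatticeEmbedding, tree:Literature.Probability.Percolation.criticalWeight_pi_div_six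
[support] 𝕋 with z x = √3(triEmbed x − (1+ζ)/3) is a member of 𝒢 whose canonical law is bond-𝕋 at
criticalWeightI(π/6): `triGraph` is preconnected (zdGraph 2 ≤ triGraph); the rhombic embedding with
this z, faces HexVertex centred at the (scaled, shifted) triangle centroids and left/right faces
`triEdgeFaces`, is isoradial (corner–centre distance √3/√3 = 1), a rhombic tiling (the rhombille
tiling), has the H21 square-grid property (two of its three parallel track families; the third
crosses both in order) and BAP(π/6) (every half-angle equals π/6), and its `isoradialPercolation` is
`bondPercolation triGraph (criticalWeightI (π/6))` (as `isoradialPercolation_squareLattice`). Glue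
value: with BondTriangularCardy it yields CardyIsoradial.IsoAnchor (term checked in the planner
sketch); with CardyIsoradial.CrossingLimitInvariance and the six square-lattice instance facts it
yields TriangularToSquareTransport. [difficulty: M] -/
@[route_item "route-CriticalPhenomena-CardyBondTriangular"]
def TriIsoradialInstance : Prop :=
  Literature.Probability.LatticeModels.triGraph.Preconnected ∧ ∃ emb : Literature.Probability.LatticeModels.RhombicEmbedding Literature.Probability.LatticeModels.triGraph Literature.Probability.LatticeModels.HexVertex, emb.z = (fun x : Literature.Probability.LatticeModels.Site 2 ↦ (Real.sqrt 3 : ℂ) * (Literature.Probability.LatticeModels.triEmbed x - (1 + Literature.Probability.LatticeModels.triZeta) / 3)) ∧ emb.IsIsoradial ∧ emb.IsRhombicTiling ∧ emb.HasSquareGridProperty ∧ emb.HasBoundedAngles (Real.pi / 6) ∧ emb.isoradialPercolation = Literature.Probability.Percolation.bondPercolation Literature.Probability.LatticeModels.triGraph (Literature.Probability.LatticeModels.criticalWeightI (Real.pi / 6))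

-- `TriIsoradialInstance` holds: proved by `Summit.CriticalPhenomena.CardyFormulaZ2.Theorems.triIsoradialInstance_proof` (its module imports this route file, so no `_holds` link can be stated here).

/-- item stmt-CriticalPhenomena-4668 · support · rank 9 · closed · proved by Summit.CriticalPhenomena.CardyFormulaZ2.Theorems.approxDiscreteCauchy_proof (prover) · by planner
sources: BollobasRiordan2006, tree:Literature.Probability.Percolation.norm_discreteTriangleIntegral_sub_mul_le, tree:Literature.Probability.Percolation.norm_discreteTriangleIntegral_sub_mul_le_local
[support] Bollobás–Riordan's Lemma 13 summation by parts with a colour-switching DEFECT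
(deterministic, provable now — kernel-checked in the unit folder with C = 24, ApproxCauchy.lean,
attached as item evidence): in the format of `norm_discreteTriangleIntegral_sub_mul_le` (arbitrary F
on face centres and g on pairs of adjacent faces of δ𝕋 inside a lattice triangular contour with n
edges per side; (10) exact, (12) |g| ≤ ε) but with (14) replaced by |g^(i+1)(w, z_(j+1)) − g^i(w,
z_j)| ≤ η at every face inside, the discrete Cauchy defect is ≤ 6nδε + C·n²·δ·η for an absolute
constant C (C = 3 expected: n² interior faces × dual edge length δ/√3 × |2ζ − 1| = √3, entering
through (15)). With η = o(δ) uniformly on compacta (n ≍ L/δ) this is the `cauchy` field of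
IsSeparatingData; it is the slot where MesoscopicColourSwitching enters. [difficulty: provable-now] -/
@[route_item "route-CriticalPhenomena-CardyBondTriangular"]
def ApproxDiscreteCauchy : Prop :=
  ∃ C : ℝ, ∀ (δ : ℝ), 0 ≤ δ → ∀ (x₀ : Literature.Probability.LatticeModels.Site 2) (n : ℕ) (s : ℝ), (s = δ ∨ s = -δ) → ∀ (F : Fin 3 → ℂ → ℝ) (g : Fin 3 → Literature.Probability.LatticeModels.HexVertex → Literature.Probability.LatticeModels.HexVertex → ℝ) (ε η : ℝ) (K : Set ℂ), convexHull ℝ ({Literature.Probability.LatticeModels.triMeshPoint δ x₀, Literature.Probability.LatticeModels.triMeshPoint δ x₀ + n * s, Literature.Probability.LatticeModels.triMeshPoint δ x₀ + n * s * Literature.Probability.LatticeModels.triZeta} : Set ℂ) ⊆ K → (∀ w : Literature.Probability.LatticeModels.HexVertex, (δ : ℂ) * Literature.Probability.LatticeModels.hexCenter w ∈ K → ∀ i j : Fin 3, |g (i + 1) w (Literature.Probability.Percolation.oppFace w (j + 1)) - g i w (Literature.Probability.Percolation.oppFace w j)| ≤ η) → (∀ w : Literature.Probability.LatticeModels.HexVertex,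 (δ : ℂ) * Literature.Probability.LatticeModels.hexCenter w ∈ K → ∀ j : Fin 3, (δ : ℂ) * Literature.Probability.LatticeModels.hexCenter (Literature.Probability.Percolation.oppFace w j) ∈ K → ∀ i : Fin 3, F i (δ * Literature.Probability.LatticeModels.hexCenter (Literature.Probability.Percolation.oppFace w j)) - F i (δ * Literature.Probability.LatticeModels.hexCenter w) = g i w (Literature.Probability.Percolation.oppFace w j) - g i (Literature.Probability.Percolation.oppFace w j) w) → (∀ w : Literature.Probability.LatticeModels.HexVertex, (δ : ℂ) * Literature.Probability.LatticeModels.hexCenter w ∈ K → ∀ i j : Fin 3, |g i w (Literature.Probability.Percolation.oppFace w j)| ≤ ε) → ∀ i : Fin 3, ‖Literature.Probability.Percolation.discreteTriangleIntegral (F (i + 1)) (Literature.Probability.LatticeModels.triMeshPoint δ x₀) s n - Literature.Probability.LatticeModels.triZeta ^ 2 * Literature.Probability.Percolation.discreteTriangleIntegral (F i) (Literature.Probability.LatticeModels.triMeshPoint δ x₀) s n‖ ≤ 6 * n * δ * ε + C * n ^ 2 * δ * η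

-- `ApproxDiscreteCauchy` holds: proved by `Summit.CriticalPhenomena.CardyFormulaZ2.Theorems.approxDiscreteCauchy_proof` (its module imports this route file, so no `_holds` link can be stated here).

/-- item stmt-CriticalPhenomena-4669 · support · rank 9 · closed · proved by Summit.CriticalPhenomena.CardyFormulaZ2.Theorems.isoAnchorGlue_proof @ b2d3e0ae4bc2 (prover) · by planner
sources: GrimmettManolescu2014Isoradial, Grimmett2014ICM, tree:Summit.CriticalPhenomena.CardyFormulaZ2.Theses.CardyIsoradial.IsoAnchor
[support] cross-route glue (provable now; term checked in the planner sketch, axioms clean):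
BondTriangularCardy → TriIsoradialInstance → IsoAnchor, where IsoAnchor is route CardyIsoradial's
rank-3 crux (stmt-CriticalPhenomena-0786) inlined verbatim — so closing BondTriangularCardy and
TriIsoradialInstance closes CardyIsoradial's anchor as well (instantiate V = Site 2, F = HexVertex,
G = triGraph, ε = π/6, rewrite the canonical law and the embedding). [difficulty: provable-now] -/
@[route_item "route-CriticalPhenomena-CardyBondTriangular"]
def IsoAnchorGlue : Prop :=
  (∀ R : Literature.Probability.RandomPlanarGeometry.ConformalRectangle, R.HasCrossingLimit (fun δ ↦ (Literature.Probability.Percolation.bondPercolation Literature.Probability.LatticeModels.triGraph (Literature.Probability.LatticeModels.criticalWeightI (Real.pi / 6))).real (Literature.Probability.Percolation.embDomainCrossing (fun x : Literature.Probability.LatticeModels.Site 2 ↦ (Real.sqrt 3 : ℂ) * (Literature.Probability.LatticeModels.triEmbed x - (1 + Literature.Probability.LatticeModels.triZeta) / 3)) R.carrier δ (R.arc 0) (R.arc 2))) Literature.Probability.RandomPlanarGeometry.cardyFunction) → (Literature.Probability.LatticeModels.triGraph.Preconnected ∧ ∃ emb : Literature.Probability.LatticeModels.RhombicEmbedding Literature.Probability.LatticeModels.triGraph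 Literature.Probability.LatticeModels.HexVertex, emb.z = (fun x : Literature.Probability.LatticeModels.Site 2 ↦ (Real.sqrt 3 : ℂ) * (Literature.Probability.LatticeModels.triEmbed x - (1 + Literature.Probability.LatticeModels.triZeta) / 3)) ∧ emb.IsIsoradial ∧ emb.IsRhombicTiling ∧ emb.HasSquareGridProperty ∧ emb.HasBoundedAngles (Real.pi / 6) ∧ emb.isoradialPercolation = Literature.Probability.Percolation.bondPercolation Literature.Probability.LatticeModels.triGraph (Literature.Probability.LatticeModels.criticalWeightI (Real.pi / 6))) → (∃ (V F : Type) (_ : Countable V) (_ : DecidableEq V) (_ : DecidableEq F) (G : SimpleGraph V) (_ : G.LocallyFinite) (emb : Literature.Probability.LatticeModels.RhombicEmbedding G F) (ε : ℝ), G.Preconnected ∧ emb.IsIsoradial ∧ emb.IsRhombicTiling ∧ emb.HasSquareGridProperty ∧ 0 < ε ∧ emb.HasBoundedAngles ε ∧ ∀ R : Literature.Probability.RandomPlanarGeometry.ConformalRectangle, R.HasCrossingLimit (fun δ ↦ emb.isoradialPercolation.real (Literature.Probability.Percolation.embDomainCrossing emb.z R.carrier δ (R.arc 0) (R.arc 2)))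 Literature.Probability.RandomPlanarGeometry.cardyFunction)

-- `IsoAnchorGlue` holds: proved by `Summit.CriticalPhenomena.CardyFormulaZ2.Theorems.isoAnchorGlue_proof` @ b2d3e0ae4bc2 (its module imports this route file, so no `_holds` link can be stated here).

-- item stmt-CriticalPhenomena-5004 · support · rank 9 · open · by planner — informal only, no Lean statement yet:
--   [support] SwitchingReduction (glue of the foreseen split of BondTriangularCardy; informal until
--   ChayesLeiHexPercolation lands): MesoscopicColourSwitching (summed form) ∧ the Bollobás–Riordan
--   percolation inputs for critical bond-𝕋 — RSW/box crossing at p = 2 sin(π/18) (Wierman1981;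
--   GrimmettManolescuAOP2013; tree fact gm_boxCrossing over 𝒢 via TriIsoradialInstance), the annulus
--   bound for three arms of which two are primal-disjoint (BR Lemma 4 analogue, tree
--   `tri_annulusCrossing_bound` pattern), duality 𝕋/hexagonal for the boundary values (BR Lemma 5
--   analogue) — together with the tree's PROVED Le

/-- item stmt-CriticalPhenomena-7023 · support · rank 9 · open · by planner
[support] RSW / box-crossing property (`HasBoxCrossingProperty`: every aspect ratio ρ > 0 has c > 0,
n₀ with all translates of [0, ρn]×[0, n] and [0, n]×[0, ρn] crossed the stated way with probability
in [c, 1−c] for n ≥ n₀) for canonical bond percolation on 𝕋 (p = criticalWeightI(π/6) = 2 sin(π/18))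
in the route's embedding z x = √3(triEmbed x − (1+ζ)/3): the a-priori percolation input of
BondTriangularCardy's layer 2 (Bollobás–Riordan Lemma 4 annulus bound ⇒ hypothesis (12) and the
boundary values of the separating probabilities; arm separation) and the per-graph endpoint of the
star–triangle transport in TriangularToSquareTransport. NEEDS-FACT (route-repair 2026-08-15, cone
audit of the 23 unproved facts in the route file's import closure): this statement is exactly what
the catalogued unproved fact `Literature.Probability.Percolation.gm_boxCrossing` (Grimmett–Manolescu
2014 Thm 1.1(a), per graph) delivers for 𝕋 through TriIsoradialInstance (instantiate G = triGraph, ε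
= π/6, then rewrite the canonical law and the embedding — term-checked in the planner sketch
SketchRSW.lean), and `Literature.Probability.Percolation.gm_boxCrossingBounds_uniform` (same
theorem, constants uniform -/
@[route_item "route-CriticalPhenomena-CardyBondTriangular", crux]
def BondTriangularBoxCrossing : Prop :=
  Literature.Probability.LatticeModels.HasBoxCrossingProperty (Literature.Probability.Percolation.bondPercolation Literature.Probability.LatticeModels.triGraph (Literature.Probability.LatticeModels.criticalWeightI (Real.pi / 6))) (fun x : Literature.Probability.LatticeModels.Site 2 ↦ (Real.sqrt 3 : ℂ) * (Literature.Probability.LatticeModels.triEmbed x - (1 + Literature.Probability.LatticeModels.triZeta) / 3))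

/-- item stmt-CriticalPhenomena-4670 · assembly · rank 1 · closed · proved by Summit.CriticalPhenomena.CardyFormulaZ2.Theorems.cardyBondTriangular_assembly_proof (prover) · by planner
sources: Grimmett2014ICM, ChayesLei2007
[assembly] BondTriangularCardy → TriangularToSquareTransport → DiscretisationBridge →
CardyFormulaZ2. -/
@[route_item "route-CriticalPhenomena-CardyBondTriangular"]
def Assembly : Prop :=
  BondTriangularCardy → TriangularToSquareTransport → DiscretisationBridge → CardyFormulaZ2

-- `Assembly` holds: proved by `Summit.CriticalPhenomena.CardyFormulaZ2.Theorems.cardyBondTriangular_assembly_proof` (its module imports this route file, so no `_holds` link can be stated here).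

/-! D-0027 §2.1 — DECIDING THEOREM (planner-authored via `route open/edit --closes-file`; by planner-rbadge-CriticalPhenomena-CardyBondTria-2624d7c6-g4-0 2026-08-15T16:10:31Z):
its hypotheses are this route's items and its conclusion the sub-problem Statement (glue_lint), and it elaborates with this file. -/

@[closes "route-CriticalPhenomena-CardyBondTriangular"] theorem closes : BondTriangularCardy → TriangularToSquareTransport → DiscretisationBridge → _root_.CardyFormulaZ2 :=
  fun hT hTr hB R => hB R (hTr _ hT R)

end Summit.CriticalPhenomena.CardyFormulaZ2.Theses.CardyBondTriangular
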